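import Summits.CriticalPhenomena.PercolationContinuityZ3.Theorems.PercAnnulusCrossingIICRerootingExact
import Summits.CriticalPhenomena.PercolationContinuityZ3.Theorems.PercAnnulusCrossingIICMultiPointPadding
import HarnessLib

/-!
# The IIC looks like an IIC from each of its points: `ν(x, y ∈ C(0)) ≍ π(‖x‖)·π(‖y − x‖)` for a site `y` near a far site `x` (lane RSW3, p1 gen 20)

builds on p205010 (kernel theorem, internal audit signed; external expert review pending) — USED through `θ(p_c) = 0` (exact re-rooting
at `p_c(ℤ^d)`, gen 10); the re-rooting identity itself is stated at any `p` with `θ(p) = 0`.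

RSW3 lane (LANE 3 `prim-rsw3`), seat `prim-rsw3-p1` (gen 20).  Helper file (`--supports stmt-CriticalPhenomena-4575`);
no definitions, no sorries.  Memo `run/shared/lean/prim/rsw3/P1-QM.md` §33.

Gen 19 (12)/(13) gave the two-point-at-two-scales formula `ν(z₀, z₁ ∈ C(0)) ≍ π(‖z₀‖)π(‖z₁‖)` for SEPARATED scales `ρ‖z₀‖ ≤ ‖z₁‖`, and
gen 20 (1b)/(4) the one-scale formula `≍ π(n)²` for separated sites at one scale.  The remaining regime — a CLOSE PAIR far away,
`‖y − x‖ ≪ ‖x‖` — is reduced to the separated-scales one by gen 10's EXACT RE-ROOTING (`ν(E ∩ {0 ↔ x}) = ν(E(· + x) ∩ {0 ↔ −x})`):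

* **`iicMeasure_real_openConn_inter_openConn_eq_reroot`** — `θ(p) = 0`, (A2)□ at aspect `(s,L)`, `2 ≤ s`: for every IIC probability measure `ν` and
  all sites `x, y`: **`ν({0 ↔ x} ∩ {0 ↔ y}) = ν({0 ↔ −x} ∩ {0 ↔ y − x})`** — the pair `(x, y)` seen from `0` is the pair `(−x, y − x)` seen from `x`;
* **`exists_iicMeasure_real_pair_two_sided_near_criticalProbI`** — at `p_c(ℤ^d)`, `d ≥ 2`, under (A2)□(s,L) + `CU⁺_l` + UAD (+ `θ(p_c) = 0`, p205010):
  there are `ρ, n₁ ≥ 1` and `0 < c ≤ C` with **`c·π_{p_c}(‖x‖)·π_{p_c}(‖y−x‖) ≤ ν(x, y ∈ C(0)) ≤ C·π_{p_c}(‖x‖)·π_{p_c}(‖y−x‖)`** for every IIC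
  probability measure `ν` and all `x, y` with `n₁ ≤ ‖y − x‖` and `ρ‖y − x‖ ≤ ‖x‖` — conditionally on containing a far site `x`, Kesten's IIC
  contains a site `y` at distance `r ≪ ‖x‖` from `x` with probability `≍ π(r)`: THE IIC LOOKS LIKE AN IIC FROM EACH OF ITS POINTS (two-point
  level).  With gen 19 (12) (separated scales) and gen 20 (1b)/(4) (one scale, separated sites) this is the pair-connectivity formula
  `ν(x, y ∈ C(0)) ≍ π(d₁)π(d₂)` (`d₁ ≤ d₂` the two smallest pairwise distances of `{0, x, y}`) in all regimes with a scale gap `ρ`.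
References: H. Kesten, Probab. Theory Relat. Fields 73 (1986) Thm. (3), (8); A. Járai, Ann. Probab. 31 (2003); D. Basu, A. Sapozhnikov,
ECP 22 (2017) Thm. 1.1, Remark 2.1.
-/

noncomputable section

namespace Summit.CriticalPhenomena.PercolationContinuityZ3.Theorems.Crossing

open MeasureTheory Filter Topology Literature.Probability.Percolation Literature.Probability.LatticeModels
open Literature.Probability.Percolation.DCT16
open Summit.CriticalPhenomena.PercolationContinuityZ3.Theorems.SurfaceTension

variable {d : ℕ}

/-! ## §1 Re-rooting a pair -/

/-- The shifted configuration joins `0` to `y` iff the configuration joins `−x` to `y − x`. [folklore] -/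
theorem preimage_relabel_shift_openConn_zero_left (x y : Site d) :
    BondConfig.relabel (sym2Equiv (Site.shift x)) ⁻¹' (openConn (0 : Site d) y : Set (BondConfig (Site d))) =
      openConn (-x) (y - x) := by
  ext ω
  simp only [Set.mem_preimage]
  have h := reachable_relabel_iff (Site.shift x) ω (-x) (y - x)
  rw [Site.shift_apply, Site.shift_apply, neg_add_cancel, sub_add_cancel] at h
  exact h

/-- **RE-ROOTING A PAIR** (`θ(p) = 0`, (A2)□ at aspect `(s,L)`, `2 ≤ s`, `0 < p`, `d ≥ 1`): for every IIC probability measure `ν` and all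
sites `x, y`: **`ν({0 ↔ x} ∩ {0 ↔ y}) = ν({0 ↔ −x} ∩ {0 ↔ y − x})`** (gen 10's exact re-rooting `ν(E ∩ {0 ↔ x}) = ν(E(· + x) ∩ {0 ↔ −x})` with
`E = {0 ↔ y}`, whose shift is `{−x ↔ y − x}`, and transitivity of connection on `{0 ↔ −x}`). [cite: BasuSapozhnikov2017ECP, Thm. 1.1 and Remark 2.1]
[cite: Kesten1986, Thm. (3)] -/
theorem iicMeasure_real_openConn_inter_openConn_eq_reroot (hd : 1 ≤ d) (p : unitInterval) (hp : 0 < (p : ℝ))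
    (hθ : theta (zdGraph d) 0 p = 0) {s L : ℕ} (hs : 2 ≤ s) {ϰ : ℝ} (hϰ : 0 < ϰ) (hA2 : SetToSetQuasiMultAspectAt d p s L ϰ)
    {ν : Measure (BondConfig (Site d))} [IsProbabilityMeasure ν]
    (hν : ∀ (F : Finset (Sym2 (Site d))) (E : Set (BondConfig (Site d))), MeasurableSet E → DeterminedBy E ↑F →
      Tendsto (fun n : ℕ => (bondPercolation (zdGraph d) p).real (E ∩ siteToBoundary d n) / oneArmProb d p n)
        atTop (𝓝 (ν.real E)))
    (x y : Site d) :
    ν.real ((openConn (0 : Site d) x : Set (BondConfig (Site d))) ∩ openConn (0 : Site d) y) =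
      ν.real ((openConn (0 : Site d) (-x) : Set (BondConfig (Site d))) ∩ openConn (0 : Site d) (y - x)) := by
  have h := iicMeasure_real_inter_openConn_eq_real_preimage_shift hd p hp hθ hs hϰ hA2 hν x
    (E := (openConn (0 : Site d) y : Set (BondConfig (Site d)))) (measurableSet_openConn_holds 0 y)
  rw [Set.inter_comm, h, preimage_relabel_shift_openConn_zero_left]
  -- on `{0 ↔ −x}`: `{−x ↔ y − x} = {0 ↔ y − x}`
  congr 1
  ext ω
  simp only [Set.mem_inter_iff]
  constructor
  · rintro ⟨hxy, h0x⟩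
    exact ⟨h0x, SimpleGraph.Reachable.trans h0x hxy⟩
  · rintro ⟨h0x, h0y⟩
    exact ⟨SimpleGraph.Reachable.trans h0x.symm h0y, h0x⟩

/-! ## §2 A near site of a far site -/

/-- **THE IIC LOOKS LIKE AN IIC FROM EACH OF ITS POINTS** (`p_c(ℤ^d)`, `d ≥ 2`; (A2)□ at aspect `(s,L)`, `2 ≤ s ≤ L`, `ϰ > 0`; `CU⁺_l(c_U)`, `l ≥ 2`,
`c_U > 0`; UAD; and `θ(p_c) = 0` via p205010 for the re-rooting): there are `ρ, n₁ ≥ 1` and `0 < c, C` such that for every IIC probability measure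
`ν` and all sites `x, y` with `n₁ ≤ ‖y − x‖_∞` and `ρ·‖y − x‖_∞ ≤ ‖x‖_∞`:
**`c·π_{p_c}(‖x‖)·π_{p_c}(‖y−x‖) ≤ ν({0 ↔ x} ∩ {0 ↔ y}) ≤ C·π_{p_c}(‖x‖)·π_{p_c}(‖y−x‖)`** — given that the far site `x` belongs to the IIC,
a site `y` at distance `r ≪ ‖x‖` from it belongs too with probability `≍ π(r)` (re-rooting at `x` + the separated-scales factorisation of
gen 19 for the pair `(y − x, −x)`). [cite: Kesten1986, Thm. (8)] [cite: BasuSapozhnikov2017ECP, Thm. 1.1] -/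
theorem exists_iicMeasure_real_pair_two_sided_near_criticalProbI (hd : 2 ≤ d) {s L : ℕ} (hs : 2 ≤ s) (hsL : s ≤ L)
    {ϰ : ℝ} (hϰ : 0 < ϰ) (hA2 : SetToSetQuasiMultAspectAt d (criticalProbI d) s L ϰ) {l : ℕ} (hl : 2 ≤ l) {cU : ℝ} (hcU : 0 < cU)
    (hCU : ∀ a : ℕ, 1 ≤ a → ∀ E : Set (BondConfig (Site d)), IsUpperSet E → MeasurableSet E →
      cU * (bondPercolation (zdGraph d) (criticalProbI d)).real E ≤ (bondPercolation (zdGraph d) (criticalProbI d)).real (E ∩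
        {ω : BondConfig (Site d) | ∀ t ∈ innerBoundary (zdGraph d) (box d a), ∀ s ∈ innerBoundary (zdGraph d) (box d (l * a)),
          ∀ t' ∈ innerBoundary (zdGraph d) (box d a), ∀ s' ∈ innerBoundary (zdGraph d) (box d (l * a)),
          ω ∈ openConnIn (↑((box d (l * a) \ box d a) ∪ innerBoundary (zdGraph d) (box d a)) : Set (Site d)) t s →
          ω ∈ openConnIn (↑((box d (l * a) \ box d a) ∪ innerBoundary (zdGraph d) (box d a)) : Set (Site d)) t' s' →
          ω ∈ openConnIn (↑((box d (l * a) \ box d a) ∪ innerBoundary (zdGraph d) (box d a)) : Set (Site d)) s s'}))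
    (hUAD : ∀ ε : ℝ, 0 < ε → ∃ K₀ : ℕ, ∀ m : ℕ, 1 ≤ m → ∀ N : ℕ, K₀ * m ≤ N →
      (bondPercolation (zdGraph d) (criticalProbI d)).real (boxCrossing d m N) ≤ ε) :
    ∃ (ρ n₁ : ℕ) (c C : ℝ), 1 ≤ ρ ∧ 1 ≤ n₁ ∧ 0 < c ∧ 0 < C ∧ ∀ (ν : Measure (BondConfig (Site d))) [IsProbabilityMeasure ν],
      (∀ (F : Finset (Sym2 (Site d))) (E : Set (BondConfig (Site d))), MeasurableSet E → DeterminedBy E ↑F →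
        Tendsto (fun n : ℕ => (bondPercolation (zdGraph d) (criticalProbI d)).real (E ∩ siteToBoundary d n) /
          oneArmProb d (criticalProbI d) n) atTop (𝓝 (ν.real E))) →
      ∀ x y : Site d, n₁ ≤ Site.supNorm (y - x) → ρ * Site.supNorm (y - x) ≤ Site.supNorm x →
        c * oneArmProb d (criticalProbI d) (Site.supNorm x) * oneArmProb d (criticalProbI d) (Site.supNorm (y - x)) ≤
            ν.real ((openConn (0 : Site d) x : Set (BondConfig (Site d))) ∩ openConn (0 : Site d) y) ∧
          ν.real ((openConn (0 : Site d) x : Set (BondConfig (Site d))) ∩ openConn (0 : Site d) y) ≤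
            C * oneArmProb d (criticalProbI d) (Site.supNorm x) * oneArmProb d (criticalProbI d) (Site.supNorm (y - x)) := by
  have hd1 : 1 ≤ d := le_trans (by norm_num) hd
  have hp : 0 < ((criticalProbI d : unitInterval) : ℝ) := by
    rw [coe_criticalProbI]; exact criticalProb_zd_pos d hd1
  have hθ : theta (zdGraph d) 0 (criticalProbI d) = 0 := CSH.percolationContinuity_allDimensions d hd
  obtain ⟨ρ, n₁, c, A, C, hρ, hn₁, hc, hA, hC, hfac⟩ :=
    exists_iicMeasure_real_biInter_openConn_two_sided_fin hd hs hsL hϰ hA2 hl hcU hCU hUAD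
  refine ⟨ρ, n₁, c ^ 2, A * C ^ 2, hρ, hn₁, by positivity, by positivity, fun ν _ hν x y hr hρr => ?_⟩
  -- re-root at `x`: the pair `(x, y)` becomes `(−x, y − x)`
  rw [iicMeasure_real_openConn_inter_openConn_eq_reroot hd1 _ hp hθ hs hϰ hA2 hν x y]
  -- the separated pair `z 0 = y − x`, `z 1 = −x`
  set z : ℕ → Site d := fun i => if i = 0 then y - x else -x with hz
  have hz0 : z 0 = y - x := by simp [hz]
  have hz1 : z 1 = -x := by simp [hz]
  have hnx : Site.supNorm (-x) = Site.supNorm x := Site.supNorm_neg x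
  have h := hfac ν hν 2 (by norm_num) z (by rw [hz0]; exact hr) (by
    intro i hi
    have hi0 : i = 0 := by omega
    subst hi0
    rw [hz0, hz1, hnx]; exact hρr)
  have hset : (⋂ i ∈ Finset.range 2, (openConn (0 : Site d) (z i) : Set (BondConfig (Site d)))) =
      (openConn (0 : Site d) (-x) : Set (BondConfig (Site d))) ∩ openConn (0 : Site d) (y - x) := by
    rw [show Finset.range 2 = {0, 1} by rfl, Finset.set_biInter_insert, Finset.set_biInter_singleton, hz0, hz1, Set.inter_comm]
  have hprod : ∏ i ∈ Finset.range 2, oneArmProb d (criticalProbI d) (Site.supNorm (z i)) =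
      oneArmProb d (criticalProbI d) (Site.supNorm (y - x)) * oneArmProb d (criticalProbI d) (Site.supNorm x) := by
    rw [Finset.prod_range_succ, Finset.prod_range_succ, Finset.prod_range_zero, one_mul, hz0, hz1, hnx]
  rw [hset, hprod, probReal_univ, mul_one] at h
  constructor
  · calc c ^ 2 * oneArmProb d (criticalProbI d) (Site.supNorm x) * oneArmProb d (criticalProbI d) (Site.supNorm (y - x))
        = c ^ 2 * (oneArmProb d (criticalProbI d) (Site.supNorm (y - x)) * oneArmProb d (criticalProbI d) (Site.supNorm x)) := by ring
      _ ≤ _ := h.1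
  · calc ν.real ((openConn (0 : Site d) (-x) : Set (BondConfig (Site d))) ∩ openConn (0 : Site d) (y - x))
        ≤ A * C ^ 2 * (oneArmProb d (criticalProbI d) (Site.supNorm (y - x)) * oneArmProb d (criticalProbI d) (Site.supNorm x)) := h.2
      _ = A * C ^ 2 * oneArmProb d (criticalProbI d) (Site.supNorm x) * oneArmProb d (criticalProbI d) (Site.supNorm (y - x)) := by ring

end Summit.CriticalPhenomena.PercolationContinuityZ3.Theorems.Crossing

end
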